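import Mathlib.Tactic.Group
import Literature.AnabelianGeometry.SemiGraphs.ArithQuasiGeometricOpenness
import Literature.AnabelianGeometry.SemiGraphs.TemperedVerticialDistinctSameVertex
import Literature.AnabelianGeometry.SemiGraphs.TemperedVerticialNamedFactsProofs
import Literature.AnabelianGeometry.SemiGraphs.TemperedFunctorialityWithHom
import HarnessLib

/-!
# [SemiAnbd] Thm 3.7 (i)(ii) ⇒ the image of `B^temp(φ)` on `π₁^temp` is CENTRALISER-FREE for a locally
# open `φ` — the input `hZ` of `outerSemidirectProductMap` (`ArithBTempOuterModel.lean`) DISCHARGED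

Mochizuki, *Semi-graphs of anabelioids*, Publ. RIMS **42** (2006), §3 Thm 3.7 (i) p. 40 ("a natural
continuous, injective outer homomorphism `π̂₁(G_v) ↪ π₁^temp(G)`"), (ii) p. 40 ("if `H₁, H₂` are verticial
subgroups … that arise from distinct parametrization data, then `H₁ ∩ H₂` has infinite index in `H₁`"),
Def 2.2 (ii) p. 24 (locally open morphisms), Def 2.4 (ii) p. 25 (verticially slim), Prop 3.6 (iv) p. 39,
§5 Thm 5.4 (iii) p. 66 [cite: MochizukiSemiAnbd2006, Thm 3.7 (ii) p.40].

PROOF-ONLY (no definition; cell abc-iut, layer L3, T54 row «T54iii·btemp-outerModel», seat abc-iut-w4-d053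
gen 4).  The functoriality theorem `outerSemidirectProductMap` of the outer semi-direct product (this seat,
`ArithBTempOuterModel.lean`, NOT imported here — its olean is not needed) carries the hypothesis
`hZ : ∀ h, (∀ y, h * φ̂ y * h⁻¹ = φ̂ y) → h = 1` ("the image of `φ̂ : π₁^temp(𝒢) → π₁^temp(ℋ)` has trivial
centraliser"); it is offered there for an OPEN image (slimness).  For a merely LOCALLY OPEN morphism
`F : 𝒢 → ℋ` of semi-graphs of anabelioids (Def 2.2 (ii): open images on the constituents only) the image
of the induced `φ̂` need not be open; here `hZ` is proved in that generality:

* `eq_one_of_centralises_open_of_isVerticialHom` — an element of `π₁^temp(ℋ)` centralising the image of an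
  OPEN subgroup `V ≤ Π_w` under a verticial homomorphism `ψ : Π_w ↪ π₁^temp(ℋ)` is trivial: it lies in
  `ψ(Π_w)` by commensurable terminality (Thm 3.7 (ii), the tree's `verticialDistinct_holds`, `[Π_w : V] < ∞`
  since `Π_w` is compact), then it is `ψ(x)` with `x` centralising `V` (Thm 3.7 (i) injectivity,
  `verticialInjective_holds`), and `x = 1` by verticial slimness (Def 2.4 (ii));
* `centraliserFree_of_chartPullbackWith_iso` — for `F : Hom 𝒢 ℋ` locally open with chart-level
  representative `φ̂` (`F^*_θ ≅ B^temp(φ̂)`, abc-iut-L3-t10's `Hom.chartPullbackWith`), every element of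
  `π₁^temp(ℋ)` centralising `φ̂(π₁^temp 𝒢)` is trivial (apply the first item at `ψ_w ∘ F_v`, up to the
  conjugator of `Hom.conj_of_chartPullbackWith_iso`).

Nothing here bears on [IUTchIII] Cor. 3.12; typed ≠ proved elsewhere.
-/

namespace Literature.AnabelianGeometry.SemiGraphs

namespace ProfiniteSemiGraph

open CategoryTheory

universe u

variable {𝒢 ℋ : ProfiniteSemiGraph.{u}}

/-- **Centralisers of open pieces of verticial subgroups are trivial** (Thm 3.7 (i) injectivity + (ii)
commensurable terminality + verticial slimness): if `h ∈ π₁^temp(ℋ)` centralises `ψ(V)` for a verticial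
homomorphism `ψ : Π_w → π₁^temp(ℋ)` and an OPEN subgroup `V ≤ Π_w`, then `h = 1`.
[cite: MochizukiSemiAnbd2006, Thm 3.7 (ii) p.40] -/
theorem eq_one_of_centralises_open_of_isVerticialHom (h37 : ℋ.Thm37Hypotheses) (c : TemperedPiChart ℋ)
    {w : ℋ.graph.Vertex} (ψ : ℋ.Gv w →ₜ* c.G) (hψ : IsVerticialHom c w ψ) (V : Subgroup (ℋ.Gv w))
    (hV : IsOpen (V : Set (ℋ.Gv w))) (h : c.G) (hc : ∀ u ∈ V, h * ψ u * h⁻¹ = ψ u) : h = 1 := by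
  have hH : ψ.toMonoidHom.range ∈ verticialSubgroups c w := ⟨ψ, hψ, rfl⟩
  have hinj : Function.Injective ψ := (verticialInjective_holds ℋ h37 c w).2 ψ hψ
  haveI : V.FiniteIndex := ArithOpenness.finiteIndex_of_isOpen_of_compactSpace V hV
  -- `ψ(V)` has finite index in `ψ(Π_w)`
  have hUH : (V.map ψ.toMonoidHom).relIndex ψ.toMonoidHom.range ≠ 0 := by
    rw [MonoidHom.range_eq_map, Subgroup.relIndex_map_map_of_injective _ _ hinj, Subgroup.relIndex_top_right]
    exact Subgroup.FiniteIndex.index_ne_zero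
  -- `ψ(V) ≤ hψ(Π_w)h⁻¹ ∩ ψ(Π_w)`, so `hψ(Π_w)h⁻¹` has finite index in `ψ(Π_w)`
  have hle : V.map ψ.toMonoidHom ≤ ψ.toMonoidHom.range.map (MulAut.conj h).toMonoidHom := by
    rintro _ ⟨u, hu, rfl⟩
    exact ⟨ψ u, ⟨u, rfl⟩, by simpa using (hc u hu)⟩
  have hne : (ψ.toMonoidHom.range.map (MulAut.conj h).toMonoidHom).relIndex ψ.toMonoidHom.range ≠ 0 :=
    fun h0 => hUH (Subgroup.relIndex_eq_zero_of_le_left hle h0)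
  -- commensurable terminality (Thm 3.7 (ii), clause 2 with `g₁ = 1`, `g₂ = h`): `h ∈ ψ(Π_w)`
  have hmem : h ∈ ψ.toMonoidHom.range := by
    by_contra hn
    have h0 := (verticialDistinct_holds ℋ h37 c).2 w _ hH 1 h (by simpa using hn)
    have h1 : ψ.toMonoidHom.range.map (MulAut.conj (1 : c.G)).toMonoidHom = ψ.toMonoidHom.range := by
      ext x; simp
    rw [h1] at h0
    exact hne h0
  obtain ⟨x, rfl⟩ := hmem
  -- `x` centralises the open `V`, hence `x = 1` by slimness of `Π_w`
  have hx : x ∈ Subgroup.centralizer (V : Set (ℋ.Gv w)) := by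
    rw [Subgroup.mem_centralizer_iff]
    intro u hu
    have := hc u hu
    change ψ x * ψ u * (ψ x)⁻¹ = ψ u at this
    rw [← map_inv, ← map_mul, ← map_mul] at this
    have hxu : x * u * x⁻¹ = u := hinj this
    calc u * x = x * u * x⁻¹ * x := by rw [hxu]
      _ = x * u := by group
  rw [(h37.isVerticiallySlim w).centralizer_eq_bot V hV, Subgroup.mem_bot] at hx
  change ψ x = 1
  rw [hx, map_one]

/-- **The image of `B^temp(φ)` on the geometric tempered groups is centraliser-free** for a LOCALLY OPEN
`F : 𝒢 → ℋ` (Def 2.2 (ii)) with chart-level representative `φ̂` (`F^*_θ ≅ B^temp(φ̂)`): every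
`h ∈ π₁^temp(ℋ)` centralising `φ̂(π₁^temp 𝒢)` is trivial — the hypothesis `hZ` of
`outerSemidirectProductMap` / `existsUnique_btemp_outerAction` (`ArithBTempOuterModel.lean`).
(`𝒢` has a vertex `v` by the standing hypotheses; `φ̂ ∘ ψ_v = conj g ∘ ψ_{F v} ∘ F_v` by
`Hom.conj_of_chartPullbackWith_iso`; apply the previous theorem to `g⁻¹ h g` and the open `F_v(Π_v)`.)
[cite: MochizukiSemiAnbd2006, Thm 5.4 (iii) p.66] -/
theorem centraliserFree_of_chartPullbackWith_iso (h𝒢 : 𝒢.Thm37Hypotheses) (hℋ : ℋ.Thm37Hypotheses)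
    (c𝒢 : TemperedPiChart 𝒢) (cℋ : TemperedPiChart ℋ) (F : Hom 𝒢 ℋ) (θ : F.ConjugatorFamily)
    (hF : F.IsLocallyOpen) (φ : c𝒢.G →ₜ* cℋ.G) (hφ : Nonempty (F.chartPullbackWith θ c𝒢 cℋ ≅ BTemp.res φ)) :
    ∀ h : cℋ.G, (∀ y : c𝒢.G, h * φ y * h⁻¹ = φ y) → h = 1 := by
  intro h hh
  obtain ⟨v⟩ := h𝒢.hasVertex
  obtain ⟨_, ψ', hψ', -⟩ := (verticialInjective_holds 𝒢 h𝒢 c𝒢 v).1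
  obtain ⟨_, ψ, hψ, -⟩ := (verticialInjective_holds ℋ hℋ cℋ (F.base.vertexMap v)).1
  obtain ⟨g, hg⟩ := F.conj_of_chartPullbackWith_iso θ c𝒢 cℋ φ hφ v ψ' ψ hψ' hψ
  -- `g⁻¹ h g` centralises `ψ(F_v(Π_v))`, an open piece of the verticial subgroup `ψ(Π_{F v})`
  have hc : ∀ u ∈ (F.hV v).toMonoidHom.range, g⁻¹ * h * g * ψ u * (g⁻¹ * h * g)⁻¹ = ψ u := by
    rintro _ ⟨x, rfl⟩
    have h1 := hh (ψ' x)
    rw [hg] at h1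
    change g⁻¹ * h * g * ψ (F.hV v x) * (g⁻¹ * h * g)⁻¹ = ψ (F.hV v x)
    calc g⁻¹ * h * g * ψ (F.hV v x) * (g⁻¹ * h * g)⁻¹
        = g⁻¹ * (h * (g * ψ (F.hV v x) * g⁻¹) * h⁻¹) * g := by group
      _ = g⁻¹ * (g * ψ (F.hV v x) * g⁻¹) * g := by rw [h1]
      _ = ψ (F.hV v x) := by group
  have h1 : g⁻¹ * h * g = 1 :=
    eq_one_of_centralises_open_of_isVerticialHom hℋ cℋ ψ hψ _ (hF.1 v) _ hc
  calc h = g * (g⁻¹ * h * g) * g⁻¹ := by group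
    _ = 1 := by rw [h1]; group

/-- In particular `π₁^temp(ℋ)` is centre-free as soon as a locally open `F : 𝒢 → ℋ` with a chart-level
representative exists (`center ≤ centraliser (φ̂ (π₁^temp 𝒢)) = 1`; of course temp-slimness, Prop 3.6 (iv),
gives this directly — recorded as the by-product it is). [cite: MochizukiSemiAnbd2006, Prop 3.6 (iv) p.39] -/
theorem center_eq_bot_of_locallyOpen_hom (h𝒢 : 𝒢.Thm37Hypotheses) (hℋ : ℋ.Thm37Hypotheses)
    (c𝒢 : TemperedPiChart 𝒢) (cℋ : TemperedPiChart ℋ) (F : Hom 𝒢 ℋ) (θ : F.ConjugatorFamily)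
    (hF : F.IsLocallyOpen) (φ : c𝒢.G →ₜ* cℋ.G) (hφ : Nonempty (F.chartPullbackWith θ c𝒢 cℋ ≅ BTemp.res φ)) :
    Subgroup.center cℋ.G = ⊥ := by
  rw [eq_bot_iff]
  intro z hz
  rw [Subgroup.mem_bot]
  refine centraliserFree_of_chartPullbackWith_iso h𝒢 hℋ c𝒢 cℋ F θ hF φ hφ z fun y => ?_
  have := (Subgroup.mem_center_iff.mp hz) (φ y)
  rw [← this]; group

end ProfiniteSemiGraph

end Literature.AnabelianGeometry.SemiGraphs
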